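import Summits.ResolutionOfSingularities.ResolutionOfSingularities.Theorems.DeltaCutRun
import HarnessLib

/-!
# DeltaCutRun2 — decomp-res node «RunCut» (lens-6 g25, critic row 190 CLEARED +1), tree file 2/7 of the node

Content VERBATIM from the decomp-res lens-6 g25 node `HOME/decomp-res-lens-6/g25/RunCut.lean` (pin e4e94516; NEW
part l. 1187–2651; the node's carry of g24 l. 89–1165 dropped in favour of `import …DeltaCutChain3` /
`…DeltaCutChainCertificates2`); HOME = run/shared/lean/pub/decomp-res; critic row 190 CLEARED +1; landing plan
NEXT-g26.md bfe16773 §4 + rider INBOX :1047 — provenance, critic text and the lens header in full in the first file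
of the node, `DeltaCutRun`.  Namespace `…Theorems.DeltaCutClasses`; `--supports stmt-ResolutionOfSingularities-26971`.

## This file

Continuation 2/3 of `DeltaCutRun` (same sections of the node, cut at the 400-line cap): carries
`badEmpty_run_of_le`, `RunTerminates`, `RunInfiniteLevel`, `RunPerpetual`, `run_trichotomy`,
`RunInfiniteLevel.not_runTerminates`, `RunPerpetual.not_runTerminates`, `RunPerpetual.not_runInfiniteLevel`,
`RunInfiniteLevel.not_runPerpetual`, `not_runTerminates_iff`, `BadAt`, `badMap`, `badSystem`, `BadThread`,
`BadThread.not_runTerminates`, `runPerpetual_iff_thread`, `not_runTerminates_iff_infiniteLevel_or_thread`,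
`WORTopChainHeavyRunTame`, `WORTopRunHeavy`, `E1TopChainHeavyRunTame`, `E1TopRunHeavy`,
`worTopChainHeavy_iff_runHeavy_runTame`, `e1TopChainHeavy_iff_runHeavy_runTame`, `WORTopRunInfiniteLevel`,
`WORTopRunPerpetual`, `E1TopRunInfiniteLevel`, `E1TopRunPerpetual`, `isLocallyNoetherian_of_isBase`,
`worTopRunHeavy_iff_infiniteLevel_perpetual`, `e1TopRunHeavy_iff_infiniteLevel_perpetual`, `isRegular_subscheme_badCentre`.

[WRITER NOTE (decomp-res writer g12): file split only (tree files ≤ 400 lines); namespace, sections, section opens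
and every declaration exactly as in the lens (the carry block and the node's global dupNamespace-linter line are
dropped — the library sets the latter; the two namespace-level `open …TwistCutClasses` / `open …LightCutClasses`
lines of the node are replayed).]

(Sources: Hironaka1967 (characteristic polyhedra); CossartJannsenSaito2020 Def. 3.13 / Thm. 3.14, Ch. 8, Thm. 9.6;
Hironaka1970 (near points / vertices); CossartPiltant2019 Prop. 2.6; CossartPiltant2008 §2; Giraud1975; Hironaka2005
(three key theorems: order under permissible blow-up); König 1927 (Kőnig's lemma) as Mathlib
`nonempty_sections_of_finite_inverse_system`; EGAIV4 §16–§17; StacksProject 0804 / 0BIQ / 031I; Matsumura1987 §28.)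
-/

noncomputable section

open CategoryTheory CategoryTheory.Limits AlgebraicGeometry TopologicalSpace IsLocalRing
open Literature.AlgebraicGeometry.Resolution

universe u

namespace Summit.ResolutionOfSingularities.ResolutionOfSingularities.Theorems.DeltaCutClasses

open Summit.ResolutionOfSingularities.ResolutionOfSingularities.Theorems.TwistCutClasses
open Summit.ResolutionOfSingularities.ResolutionOfSingularities.Theorems.LightCutClasses

section RunLaw

open Summit.ResolutionOfSingularities.ResolutionOfSingularities.Theorems
open WeakOrderReduction ForcedTowerClasses SubfieldContactClasses AbsoluteContactClasses PurityValveClasses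
open Scheme.IdealSheafData (vanishingIdeal)

/-- an EMPTY level of the run is followed by empty levels only. [new] [folklore] -/
theorem badEmpty_run_of_le (n : ℕ) (N : Stage) [IsLocallyNoetherian N.Y] {i j : ℕ} (hij : i ≤ j)
    (h : BadEmpty n (run n N i)) : BadEmpty n (run n N j) := by
  induction j, hij using Nat.le_induction with
  | base => exact h
  | succ j _ ih =>
    haveI := run_isLocallyNoetherian n N j
    exact badEmpty_hop_of_badEmpty n (run n N j) ih

/-- **`RunTerminates n N` — THE DECIDED LETTER**: some level of the canonical bad run has EMPTY bad locus, all
earlier levels having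
FINITE bad locus (so the run really blew up at every earlier level; the least such level is the TERMINATION HEIGHT).
DEFINITION (letter, decided). -/
def RunTerminates (n : ℕ) (N : Stage) : Prop :=
  ∃ i : ℕ, (∀ j < i, BadFinite n (run n N j)) ∧ BadEmpty n (run n N i)

/-- **`RunInfiniteLevel n N` — RESIDUAL KIND A**: some level of the run has INFINITE bad locus, all earlier levels
finite (the run
freezes there: a curve / surface of wild δ-heavy closed top points appears). DEFINITION (letter, residual kind A). -/
def RunInfiniteLevel (n : ℕ) (N : Stage) : Prop :=
  ∃ i : ℕ, (∀ j < i, BadFinite n (run n N j)) ∧ ¬ BadFinite n (run n N i)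

/-- **`RunPerpetual n N` — RESIDUAL KIND B**: EVERY level of the run has a FINITE NONEMPTY bad locus (the run blows up forever).
DEFINITION (letter, residual kind B). -/
def RunPerpetual (n : ℕ) (N : Stage) : Prop :=
  ∀ i : ℕ, BadFinite n (run n N i) ∧ (badLocus (run n N i).Y (run n N i).I n).Nonempty

/-- **TRICHOTOMY (existence, pure logic)**: every run TERMINATES, or reaches an INFINITE LEVEL, or is PERPETUAL (least infinite
level by `Nat.find`). [new] [folklore] -/
theorem run_trichotomy (n : ℕ) (N : Stage) : RunTerminates n N ∨ RunInfiniteLevel n N ∨ RunPerpetual n N := by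
  classical
  by_cases hfin : ∀ i, BadFinite n (run n N i)
  · by_cases hemp : ∃ i, BadEmpty n (run n N i)
    · obtain ⟨i, hi⟩ := hemp
      exact Or.inl ⟨i, fun j _ => hfin j, hi⟩
    · push Not at hemp
      exact Or.inr (Or.inr fun i => ⟨hfin i, Set.nonempty_iff_ne_empty.2 (hemp i)⟩)
  · push Not at hfin
    exact Or.inr (Or.inl ⟨Nat.find hfin, fun j hj => not_not.1 (Nat.find_min hfin hj), Nat.find_spec hfin⟩)

/-- **TRICHOTOMY (exclusivity A/terminates)** — uses LEMMA A: an empty level propagates upward, so no later level is infinite;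
an earlier infinite level contradicts the finite prefix. [new] [folklore] -/
theorem RunInfiniteLevel.not_runTerminates {n : ℕ} {N : Stage} [IsLocallyNoetherian N.Y] (h : RunInfiniteLevel n N) :
    ¬ RunTerminates n N := by
  rintro ⟨i, hpre, hemp⟩
  obtain ⟨i', hpre', hinf⟩ := h
  rcases lt_or_ge i' i with hlt | hle
  · exact hinf (hpre i' hlt)
  · refine hinf ?_
    rw [BadFinite, show badLocus (run n N i').Y (run n N i').I n = ∅ from badEmpty_run_of_le n N hle hemp]
    exact Set.finite_empty

/-- **TRICHOTOMY (exclusivity B/terminates)** (pure logic). [new] [folklore] -/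
theorem RunPerpetual.not_runTerminates {n : ℕ} {N : Stage} (h : RunPerpetual n N) : ¬ RunTerminates n N := by
  rintro ⟨i, -, hemp⟩
  exact (h i).2.ne_empty hemp

/-- **TRICHOTOMY (exclusivity B/A)** (pure logic). [new] [folklore] -/
theorem RunPerpetual.not_runInfiniteLevel {n : ℕ} {N : Stage} (h : RunPerpetual n N) : ¬ RunInfiniteLevel n N := by
  rintro ⟨i, -, hinf⟩
  exact hinf (h i).1

/-- **TRICHOTOMY (exclusivity A/B)** (pure logic). [new] [folklore] -/
theorem RunInfiniteLevel.not_runPerpetual {n : ℕ} {N : Stage} (h : RunInfiniteLevel n N) : ¬ RunPerpetual n N :=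
  fun hP => hP.not_runInfiniteLevel h

/-- **THE RESIDUAL LETTER UNFOLDED EXACTLY**: `¬ RunTerminates ⟺ RunInfiniteLevel ∨ RunPerpetual` (kinds A ∣ B).
[new] [folklore] -/
theorem not_runTerminates_iff (n : ℕ) (N : Stage) [IsLocallyNoetherian N.Y] :
    ¬ RunTerminates n N ↔ RunInfiniteLevel n N ∨ RunPerpetual n N :=
  ⟨fun h => (run_trichotomy n N).resolve_left h,
    fun h => h.elim (fun hA => hA.not_runTerminates) fun hB => hB.not_runTerminates⟩

end RunLaw

section RunKonig

open Summit.ResolutionOfSingularities.ResolutionOfSingularities.Theorems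
open WeakOrderReduction ForcedTowerClasses SubfieldContactClasses AbsoluteContactClasses PurityValveClasses

/-! ### §RunKonig — KÖNIG IN KERNEL: a perpetual run carries an INFINITE BAD THREAD (Mathlib
`nonempty_sections_of_finite_inverse_system`) -/

/-- the bad locus of level `i` of the run, as a type. DEFINITION (support). -/
def BadAt (n : ℕ) (N : Stage) (i : ℕ) : Type := ↥(badLocus (run n N i).Y (run n N i).I n)

/-- LEMMA A as a map of bad loci `bad_{i+1} → bad_i`. DEFINITION (support). -/
def badMap (n : ℕ) (N : Stage) [IsLocallyNoetherian N.Y] (i : ℕ) : BadAt n N (i + 1) → BadAt n N i :=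
  fun y => ⟨(runHom n N i).base y.1, runHom_base_mem n N i y.2⟩

/-- **THE INVERSE SYSTEM OF BAD LOCI** `ℕᵒᵖ ⥤ Type` of the run (`CategoryTheory.Functor.ofOpSequence` of the maps `badMap`).
DEFINITION (support). -/
def badSystem (n : ℕ) (N : Stage) [IsLocallyNoetherian N.Y] : ℕᵒᵖ ⥤ Type :=
  Functor.ofOpSequence (X := BadAt n N) fun i => TypeCat.ofHom (badMap n N i)

/-- **A BAD THREAD of the run**: a bad point at EVERY level, consecutive ones mapped onto each other by the hops — an INFINITE
chain `y₀ ← y₁ ← y₂ ← ⋯` of wild δ-heavy closed top points, `y_{i+1}` a NEAR point of `y_i` in the canonical run.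
DEFINITION (support). -/
structure BadThread (n : ℕ) (N : Stage) where
  /-- the point of the thread at level `i` -/
  pt : ∀ i : ℕ, ↥(run n N i).Y
  /-- it is a bad point of level `i` -/
  mem : ∀ i : ℕ, pt i ∈ badLocus (run n N i).Y (run n N i).I n
  /-- the hop maps the next point to this one -/
  map_pt : ∀ i : ℕ, (runHom n N i).base (pt (i + 1)) = pt i

/-- a bad thread forbids termination (pure logic). [new] [folklore] -/
theorem BadThread.not_runTerminates {n : ℕ} {N : Stage} (T : BadThread n N) : ¬ RunTerminates n N := by
  rintro ⟨i, -, hemp⟩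
  have hmem := T.mem i
  rw [show badLocus (run n N i).Y (run n N i).I n = ∅ from hemp] at hmem
  exact hmem

/-- **KÖNIG IN KERNEL (both directions)**: the run is PERPETUAL iff every level has FINITE bad locus and there is a BAD THREAD.
`→`: the bad loci form an inverse system of FINITE NONEMPTY types (`badSystem`, maps = LEMMA A), whose limit is nonempty by
Mathlib's `nonempty_sections_of_finite_inverse_system` (Kőnig's lemma / Tychonoff); a section is a thread
(`Functor.ofOpSequence_map_homOfLE_succ`). `←`: a thread makes every level nonempty. [new] [folklore] -/
theorem runPerpetual_iff_thread (n : ℕ) (N : Stage) [IsLocallyNoetherian N.Y] :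
    RunPerpetual n N ↔ (∀ i, BadFinite n (run n N i)) ∧ Nonempty (BadThread n N) := by
  constructor
  · intro h
    refine ⟨fun i => (h i).1, ?_⟩
    haveI : ∀ j : ℕᵒᵖ, Finite ((badSystem n N).obj j) := fun j => (h j.unop).1.to_subtype
    haveI : ∀ j : ℕᵒᵖ, Nonempty ((badSystem n N).obj j) := fun j => (h j.unop).2.to_subtype
    obtain ⟨s, hs⟩ := nonempty_sections_of_finite_inverse_system (badSystem n N)
    refine ⟨⟨fun i => (s (Opposite.op i)).1, fun i => (s (Opposite.op i)).2, fun i => ?_⟩⟩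
    have hsi := @hs (Opposite.op (i + 1)) (Opposite.op i) (homOfLE (Nat.le_add_right i 1)).op
    rw [show (badSystem n N).map (homOfLE (Nat.le_add_right i 1)).op = TypeCat.ofHom (badMap n N i) from
      Functor.ofOpSequence_map_homOfLE_succ _ i] at hsi
    have hsi' : badMap n N i (s (Opposite.op (i + 1))) = s (Opposite.op i) := hsi
    exact congrArg Subtype.val hsi'
  · rintro ⟨hfin, ⟨T⟩⟩ i
    exact ⟨hfin i, ⟨T.pt i, T.mem i⟩⟩

/-- **EXACTNESS OF THE RESIDUAL (hyp-free over locally Noetherian stages)**: the canonical bad run does NOT terminate iff it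
reaches an INFINITE level (kind A) or every level is finite and it carries an INFINITE BAD THREAD (kind B). [new] [folklore] -/
theorem not_runTerminates_iff_infiniteLevel_or_thread (n : ℕ) (N : Stage) [IsLocallyNoetherian N.Y] :
    ¬ RunTerminates n N ↔ RunInfiniteLevel n N ∨ ((∀ i, BadFinite n (run n N i)) ∧ Nonempty (BadThread n N)) := by
  rw [not_runTerminates_iff, runPerpetual_iff_thread]

end RunKonig

section RunCells

open Summit.ResolutionOfSingularities.ResolutionOfSingularities.Theorems
open WeakOrderReduction ForcedTowerClasses SubfieldContactClasses AbsoluteContactClasses PurityValveClasses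

/-! ### §RunCells — THE CELLS OF THE RUN CUT, the EXACT hypothesis-free carve of `WORTopChainHeavy` / `E1TopChainHeavy` -/

/-- **THE DECIDED CELL · `WORTopChainHeavyRunTame n`** — weak resolution for the chain-heavy base data at marking `n` whose
CANONICAL BAD RUN TERMINATES (`RunTerminates n (Y, 𝓘)`).  DECIDED (PROVED below from `SeqDimFour 5 n` by the ITERATED engine
`wor_of_runTerminates`). -/
def WORTopChainHeavyRunTame (n : ℕ) : Prop :=
  ∀ p : ℕ, p.Prime → ∀ (k : Type) [Field k] [CharP k p] (Y : Scheme.{0}) (g : Y ⟶ Spec (.of k)),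
    IsBase Y g → ∀ M : MarkedIdeal Y, IsDatum n M → TopHeavy Y M.ideal n → TopDeltaHeavy Y M.ideal n →
      TopChainHeavy Y M.ideal n → RunTerminates n ⟨Y, M.ideal⟩ → ∃ t : CentreSeq Y, WeakResolution t M

/-- **THE RESIDUAL CELL · `WORTopRunHeavy n`** — weak resolution for the base data at marking `n` whose canonical
bad run does NOT
terminate (it reaches a level with INFINITELY many bad points — kind A —, or blows up finitely many bad points FOREVER along an
infinite bad thread — kind B; exact: `not_runTerminates_iff_infiniteLevel_or_thread`).  RESIDUAL (the located successor of
`WORTopChainHeavy n`). -/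
def WORTopRunHeavy (n : ℕ) : Prop :=
  ∀ p : ℕ, p.Prime → ∀ (k : Type) [Field k] [CharP k p] (Y : Scheme.{0}) (g : Y ⟶ Spec (.of k)),
    IsBase Y g → ∀ M : MarkedIdeal Y, IsDatum n M → TopHeavy Y M.ideal n → TopDeltaHeavy Y M.ideal n →
      TopChainHeavy Y M.ideal n → ¬ RunTerminates n ⟨Y, M.ideal⟩ → ∃ t : CentreSeq Y, WeakResolution t M

/-- **THE DECIDED family · `E1TopChainHeavyRunTame`**. DECIDED. -/
def E1TopChainHeavyRunTame : Prop := ∀ n : ℕ, 1 ≤ n → WORTopChainHeavyRunTame n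

/-- **THE RESIDUAL (family) · `E1TopRunHeavy`** — THE LOCATED RESIDUAL of the lens-6 column after g25. RESIDUAL. -/
def E1TopRunHeavy : Prop := ∀ n : ℕ, 1 ≤ n → WORTopRunHeavy n

/-- **EXACT CARVE at one marking** (hypothesis-free): `WORTopChainHeavy n ⟺ WORTopRunHeavy n ∧ WORTopChainHeavyRunTame n`
(excluded middle on `RunTerminates`). [new] [folklore] -/
theorem worTopChainHeavy_iff_runHeavy_runTame (n : ℕ) :
    WORTopChainHeavy n ↔ WORTopRunHeavy n ∧ WORTopChainHeavyRunTame n := by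
  constructor
  · intro h
    exact ⟨fun p hp k _ _ Y g hB M hM hT hD hC _ => h p hp k Y g hB M hM hT hD hC,
      fun p hp k _ _ Y g hB M hM hT hD hC _ => h p hp k Y g hB M hM hT hD hC⟩
  · rintro ⟨hR, hD⟩ p hp k _ _ Y g hB M hM hT hDH hC
    by_cases hr : RunTerminates n ⟨Y, M.ideal⟩
    · exact hD p hp k Y g hB M hM hT hDH hC hr
    · exact hR p hp k Y g hB M hM hT hDH hC hr

/-- **EXACT CARVE of the family** (hypothesis-free): `E1TopChainHeavy ⟺ E1TopRunHeavy ∧ E1TopChainHeavyRunTame`.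
[new] [folklore] -/
theorem e1TopChainHeavy_iff_runHeavy_runTame : E1TopChainHeavy ↔ E1TopRunHeavy ∧ E1TopChainHeavyRunTame := by
  constructor
  · intro h
    exact ⟨fun n hn => ((worTopChainHeavy_iff_runHeavy_runTame n).1 (h n hn)).1,
      fun n hn => ((worTopChainHeavy_iff_runHeavy_runTame n).1 (h n hn)).2⟩
  · rintro ⟨hR, hD⟩ n hn
    exact (worTopChainHeavy_iff_runHeavy_runTame n).2 ⟨hR n hn, hD n hn⟩

/-- **RESIDUAL SUB-CELL of KIND A · `WORTopRunInfiniteLevel n`** — the run reaches a level with INFINITELY MANY bad points.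
RESIDUAL (kind A). -/
def WORTopRunInfiniteLevel (n : ℕ) : Prop :=
  ∀ p : ℕ, p.Prime → ∀ (k : Type) [Field k] [CharP k p] (Y : Scheme.{0}) (g : Y ⟶ Spec (.of k)),
    IsBase Y g → ∀ M : MarkedIdeal Y, IsDatum n M → TopHeavy Y M.ideal n → TopDeltaHeavy Y M.ideal n →
      TopChainHeavy Y M.ideal n → RunInfiniteLevel n ⟨Y, M.ideal⟩ → ∃ t : CentreSeq Y, WeakResolution t M

/-- **RESIDUAL SUB-CELL of KIND B · `WORTopRunPerpetual n`** — the run blows up finitely many bad points FOREVER (equivalently: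
every level finite and an INFINITE BAD THREAD exists, `runPerpetual_iff_thread`).  RESIDUAL (kind B). -/
def WORTopRunPerpetual (n : ℕ) : Prop :=
  ∀ p : ℕ, p.Prime → ∀ (k : Type) [Field k] [CharP k p] (Y : Scheme.{0}) (g : Y ⟶ Spec (.of k)),
    IsBase Y g → ∀ M : MarkedIdeal Y, IsDatum n M → TopHeavy Y M.ideal n → TopDeltaHeavy Y M.ideal n →
      TopChainHeavy Y M.ideal n → RunPerpetual n ⟨Y, M.ideal⟩ → ∃ t : CentreSeq Y, WeakResolution t M

/-- RESIDUAL kind-A family. RESIDUAL. -/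
def E1TopRunInfiniteLevel : Prop := ∀ n : ℕ, 1 ≤ n → WORTopRunInfiniteLevel n

/-- RESIDUAL kind-B family. RESIDUAL. -/
def E1TopRunPerpetual : Prop := ∀ n : ℕ, 1 ≤ n → WORTopRunPerpetual n

/-- base data are locally Noetherian (tree: locally of finite type over a field). [folklore] -/
theorem isLocallyNoetherian_of_isBase {k : Type} [Field k] {Y : Scheme.{0}} {g : Y ⟶ Spec (.of k)} (hB : IsBase Y g) :
    IsLocallyNoetherian Y := by
  haveI := hB.locallyOfFiniteType
  exact LocallyOfFiniteType.isLocallyNoetherian g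

/-- **EXACT CARVE OF THE RESIDUAL INTO ITS TWO KINDS** (hypothesis-free; trichotomy + exclusivity):
`WORTopRunHeavy n ⟺ WORTopRunInfiniteLevel n ∧ WORTopRunPerpetual n`. [new] [folklore] -/
theorem worTopRunHeavy_iff_infiniteLevel_perpetual (n : ℕ) :
    WORTopRunHeavy n ↔ WORTopRunInfiniteLevel n ∧ WORTopRunPerpetual n := by
  constructor
  · intro h
    refine ⟨fun p hp k _ _ Y g hB M hM hT hD hC hA => ?_, fun p hp k _ _ Y g hB M hM hT hD hC hP => ?_⟩
    · haveI : IsLocallyNoetherian (⟨Y, M.ideal⟩ : Stage).Y := isLocallyNoetherian_of_isBase hB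
      exact h p hp k Y g hB M hM hT hD hC hA.not_runTerminates
    · exact h p hp k Y g hB M hM hT hD hC hP.not_runTerminates
  · rintro ⟨hA, hP⟩ p hp k _ _ Y g hB M hM hT hD hC hr
    haveI : IsLocallyNoetherian (⟨Y, M.ideal⟩ : Stage).Y := isLocallyNoetherian_of_isBase hB
    rcases (not_runTerminates_iff n ⟨Y, M.ideal⟩).1 hr with h | h
    · exact hA p hp k Y g hB M hM hT hD hC h
    · exact hP p hp k Y g hB M hM hT hD hC h

/-- the same for the families: `E1TopRunHeavy ⟺ E1TopRunInfiniteLevel ∧ E1TopRunPerpetual`. [new] [folklore] -/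
theorem e1TopRunHeavy_iff_infiniteLevel_perpetual : E1TopRunHeavy ↔ E1TopRunInfiniteLevel ∧ E1TopRunPerpetual := by
  constructor
  · intro h
    exact ⟨fun n hn => ((worTopRunHeavy_iff_infiniteLevel_perpetual n).1 (h n hn)).1,
      fun n hn => ((worTopRunHeavy_iff_infiniteLevel_perpetual n).1 (h n hn)).2⟩
  · rintro ⟨hA, hP⟩ n hn
    exact (worTopRunHeavy_iff_infiniteLevel_perpetual n).2 ⟨hA n hn, hP n hn⟩

end RunCells

section RunEngine

open Summit.ResolutionOfSingularities.ResolutionOfSingularities.Theorems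
open WeakOrderReduction ForcedTowerClasses SubfieldContactClasses AbsoluteContactClasses PurityValveClasses
open Scheme.IdealSheafData (vanishingIdeal)

/-! ### §RunEngine — THE ENGINE ITERATED IN KERNEL: a datum whose canonical bad run TERMINATES has a weak resolution -/

/-- the reduced FINITE bad locus is a REGULAR centre (g24 `isRegular_subscheme_vanishingIdeal_finset`). [folklore] -/
theorem isRegular_subscheme_badCentre (n : ℕ) (N : Stage) [IsLocallyNoetherian N.Y] (h : BadFinite n N) :
    Scheme.IsRegular (badCentre n N h).subscheme := by
  obtain ⟨s, hs⟩ := Set.Finite.exists_finset_coe h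
  have hcl : ∀ y ∈ s, IsClosed ({y} : Set N.Y) := fun y hy => by
    have hy' : y ∈ badLocus N.Y N.I n := by rw [← hs]; exact hy
    exact hy'.1
  have hSc : IsClosed ((s : Set N.Y)) := isClosed_of_finite_of_isClosed_singleton s.finite_toSet hcl
  have heq : badCentre n N h = vanishingIdeal ⟨(s : Set N.Y), hSc⟩ := by
    unfold badCentre; congr 1; exact Closeds.ext hs.symm
  rw [heq]
  exact isRegular_subscheme_vanishingIdeal_finset s hcl hSc

end RunEngine

end Summit.ResolutionOfSingularities.ResolutionOfSingularities.Theorems.DeltaCutClasses
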